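import Summits.BirchSwinnertonDyer.BirchSwinnertonDyer.Theorems.EisensteinPrimesAnomalousTowerTorsionFinite
import HarnessLib

/-!
# Route `EisensteinPrimes`, crux 2 `GoodLatticeBDPValue` (stmt-BirchSwinnertonDyer-19032), line `halves`, V20 road
# brick (f), part 6: the EXACT anomalous local term at `v̄` — `E(K_{∞,v̄})[p^∞]` is a finite group with `p`-torsion
# `E(K_v̄)[p]`, and the local Kummer kernel has order EXACTLY `#E(K_v̄)[p]`

Cell `bsd-eis` (home `run/shared/lean/pub/bsd-eis/`), width seat `bsd-line-x1-p1-w2` gen 3 (`--supports -19032`,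
closes nothing). Parts 2–3 bound the local Kummer kernel `ker(H¹(K_{∞,v̄}, E[p]) → H¹(K_{∞,v̄}, E[p^∞]))` by `p` and
identify `E_K[p]^{D_v̄ ⊓ ker κ} = E_K[p]^{D_v̄}`; part 5 proves Fin_v (`E(K_{∞,v̄})[p^∞]` finite) for every `ℤ_p`-extension
ramified at `v̄`, in particular the anticyclotomic one. With UTD's exact count `natCard_ker_kummer_eq_natCard_fixed_torsion`
(`#ker = #E[p]^G` once `E[p^∞]^G` is finite) this gives the EXACT E-side local term of the residual dévissage at the
anomalous place (KY §1.4 Cases I–III: the term is `#H⁰(K_v̄, M_f)[𝔭] = #E(ℚ_p)[p] ∈ {1, p}`), on the binders of crux 2: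

* `mem_fixedPoints_decompIn_iff` — the two spellings `decompIn (ker κ) v̄ ≤ D_v̄` and `D_v̄ ⊓ ker κ ≤ Γ_K` of the local
  tower group have the same fixed points;
* **`natCard_ker_kummer_decompIn_eq`** — for every `κ` with `κ(I_v̄) ≠ 1`:
  `#ker(H¹(K_{∞,v̄}, E[p]) → H¹(K_{∞,v̄}, E[p^∞])) = #E_K[p]^{D_v̄}` (the `K_v̄ = ℚ_p`-rational `p`-torsion);
* **`natCard_ker_kummer_decompIn_eq_of_isAnticyclotomic`** — the same on the anticyclotomic tower;
* `finite_and_natCard_fixedPoints_decomp_le` — `E(K_{∞,v̄})[p^∞]` is finite and `#E_K[p]^{D_v̄} ≤ p` (KY Prop.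
  1.3.3 (ii)–(iii): «finite and cyclic»).

HONEST FRAMING: helper theorems only (0 definitions, 0 named facts, 0 sorry); no summit statement, no BSD / IMC2 / KY
Thm 1.4.1 (iii) is proved; 0 cells / labels move. References: [KellerYin2024] §1.3 Prop. 1.3.3 (ii)–(iii), Lemma 1.3.5,
§1.4 Cases I–III (arXiv:2402.12781v2 TeX L922–960, L1009–1046, L1142–1160); [GreenbergLNM1716] §3 proof of Lemma 3.1.
-/

set_option autoImplicit false
-- the route's Theorems namespace repeats the summit name by design (D-0017 nested layout)
set_option linter.dupNamespace false

noncomputable section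

open scoped Classical

namespace Summit.BirchSwinnertonDyer.BirchSwinnertonDyer.Theorems.AnomalousLocalTorsion

open NumberField IsDedekindDomain Field WeierstrassCurve
  Literature.NumberTheory.EllipticCurves Literature.NumberTheory.EllipticCurves.GreenbergSelmer
  Literature.NumberTheory.EllipticCurves.Rank1Residual Literature.NumberTheory.GaloisRepresentations
  Summit.BirchSwinnertonDyer.BirchSwinnertonDyer.Theorems.SchneiderFreeControlAtoms

variable (W : WeierstrassCurve ℚ) [W.IsElliptic] [W.IsGloballyMinimal] {p : ℕ} [hp : Fact p.Prime]
  {K : Type} [Field K] [NumberField K] (κ : ZpExtension K p)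

omit [W.IsElliptic] [W.IsGloballyMinimal] in
/-- The two spellings of the local tower group — `decompIn (ker κ) v ≤ D_v` and `D_v ⊓ ker κ ≤ Γ_K` — have the same
fixed points on any `Γ_K`-module. [folklore] -/
theorem mem_fixedPoints_decompIn_iff {M : Type} [AddCommGroup M] [DistribMulAction (absoluteGaloisGroup K) M]
    (v : HeightOneSpectrum (𝓞 K)) (m : M) :
    m ∈ FixedPoints.addSubgroup (decompIn κ.kerSubgroup v) M ↔
      m ∈ FixedPoints.addSubgroup ↥(GreenbergSelmer.decomp v ⊓ κ.kerSubgroup) M := by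
  rw [FixedPoints.mem_addSubgroup, FixedPoints.mem_addSubgroup]
  constructor
  · rintro h ⟨g, hg⟩
    obtain ⟨hgD, hgk⟩ := Subgroup.mem_inf.mp hg
    have h' := h ⟨⟨g, hgD⟩, (mem_decompIn_iff κ.kerSubgroup v _).mpr hgk⟩
    exact h'
  · rintro h ⟨⟨g, hgD⟩, hgH⟩
    have hgk : g ∈ κ.kerSubgroup := (mem_decompIn_iff κ.kerSubgroup v _).mp hgH
    exact h ⟨g, Subgroup.mem_inf.mpr ⟨hgD, hgk⟩⟩

/-- **The EXACT local Kummer kernel at the anomalous place: `#ker(H¹(K_{∞,v̄}, E[p]) → H¹(K_{∞,v̄}, E[p^∞])) = #E_K[p]^{D_v̄}`**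
(`= #E(K_v̄)[p] = #E(ℚ_p)[p] ∈ {1, p}`), on the binders of crux 2 and for EVERY `ℤ_p`-extension `κ` with `κ(I_v̄) ≠ 1`:
Fin_v (`localTowerTorsionFiniteAt_of_exists_inertia_apply_ne_one`) makes UTD's count exact (`#ker = #E_K[p]^{D_v̄ ⊓ ker κ}`),
and the local tower adds no `p`-torsion (`smul_eq_of_mem_fixedPoints_decompIn_geomTorsion`). KY's Cases I–III: the term is
`#ker(res_{M_f[𝔭]}) = #𝔽` or `1` according as `H⁰(K_v̄, M_f) ≠ 0` or `= 0`.
[cite: KellerYin2024, §1.3 Lemma 1.3.5, §1.4 Cases I–III (arXiv:2402.12781v2 TeX L1009–1046, L1142–1160)]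
[cite: GreenbergLNM1716, §3 proof of Lemma 3.1] -/
theorem natCard_ker_kummer_decompIn_eq (hp2 : p ≠ 2) (hanom : Anom W p)
    (hGL : ∀ Φ : AddSubgroup (geomTorsion W (p : ℤ)), IsRationalLine W p Φ → ¬ LineUnramifiedAt W p Φ)
    (hK : IsImaginaryQuadratic K) {v vbar : HeightOneSpectrum (𝓞 K)} (hpv : ((p : ℕ) : 𝓞 K) ∈ v.asIdeal)
    (hpvbar : ((p : ℕ) : 𝓞 K) ∈ vbar.asIdeal) (hne : vbar ≠ v)
    (hram : ∃ τ ∈ GreenbergSelmer.inertia vbar, κ τ ≠ 1) :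
    Nat.card ((resH1Hom (ContinuousMonoidHom.id (decompIn κ.kerSubgroup vbar))
        (AddSubgroup.inclusion (geomTorsion_le_geomPrimaryTorsion (W.baseChange K) p)) (fun _ _ ↦ rfl) :
          subgroupH1 (decompIn κ.kerSubgroup vbar) (geomTorsion (W.baseChange K) (p : ℤ)) →+
            subgroupH1 (decompIn κ.kerSubgroup vbar) ((W.baseChange K).geomPrimaryTorsion p)).ker) =
      Nat.card (FixedPoints.addSubgroup (GreenbergSelmer.decomp vbar) (geomTorsion (W.baseChange K) (p : ℤ))) := by
  -- Fin_v, transported to the `decompIn` spelling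
  have hfin : (FixedPoints.addSubgroup (decompIn κ.kerSubgroup vbar) ((W.baseChange K).geomPrimaryTorsion p) :
      Set ((W.baseChange K).geomPrimaryTorsion p)).Finite := by
    have h := localTowerTorsionFiniteAt_of_exists_inertia_apply_ne_one W hp2 hanom hGL hK hpv hpvbar hne κ hram
    unfold LocalTowerTorsionFiniteAt at h
    refine h.subset fun m hm ↦ ?_
    exact (mem_fixedPoints_decompIn_iff κ vbar m).mp hm
  rw [UniversalToricDescentLocalKummer.natCard_ker_kummer_eq_natCard_fixed_torsion (W.baseChange K) p
    (decompIn κ.kerSubgroup vbar) hfin]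
  -- `E_K[p]^{D_v̄ ⊓ ker κ} = E_K[p]^{D_v̄}`
  refine Nat.card_congr (Equiv.ofBijective (fun x ↦ (⟨(x : geomTorsion (W.baseChange K) (p : ℤ)), fun d ↦ ?_⟩ :
    FixedPoints.addSubgroup (GreenbergSelmer.decomp vbar) (geomTorsion (W.baseChange K) (p : ℤ))))
    ⟨fun a b h ↦ ?_, fun y ↦ ?_⟩)
  · change ((d : absoluteGaloisGroup K)) • (x : geomTorsion (W.baseChange K) (p : ℤ)) = x
    exact smul_eq_of_mem_fixedPoints_decompIn_geomTorsion W κ hp2 hanom hGL hK hpv hpvbar hne x.2 d.2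
  · exact Subtype.ext (congrArg (fun z : FixedPoints.addSubgroup (GreenbergSelmer.decomp vbar)
      (geomTorsion (W.baseChange K) (p : ℤ)) ↦ (z : geomTorsion (W.baseChange K) (p : ℤ))) h)
  · refine ⟨⟨(y : geomTorsion (W.baseChange K) (p : ℤ)), (FixedPoints.mem_addSubgroup _ _ _).mpr fun h ↦ ?_⟩, rfl⟩
    have hy := (FixedPoints.mem_addSubgroup _ _ _).mp y.2 (h : GreenbergSelmer.decomp vbar)
    exact hy

/-- **The exact local Kummer kernel on the ANTICYCLOTOMIC tower**: `#ker(H¹(K^{ac}_{∞,v̄}, E[p]) → H¹(K^{ac}_{∞,v̄}, E[p^∞]))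
= #E_K[p]^{D_v̄}` at a good anomalous `p`, on the binders of crux 2. [cite: KellerYin2024, §1.3 Lemma 1.3.5, §1.4 Cases I–III (arXiv:2402.12781v2 TeX L1009–1046, L1142–1160)]
[cite: Brink2007, Cor. 1] -/
theorem natCard_ker_kummer_decompIn_eq_of_isAnticyclotomic (hp2 : p ≠ 2) (hanom : Anom W p)
    (hGL : ∀ Φ : AddSubgroup (geomTorsion W (p : ℤ)), IsRationalLine W p Φ → ¬ LineUnramifiedAt W p Φ)
    (hK : IsImaginaryQuadratic K) {v vbar : HeightOneSpectrum (𝓞 K)} (hpv : ((p : ℕ) : 𝓞 K) ∈ v.asIdeal)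
    (hpvbar : ((p : ℕ) : 𝓞 K) ∈ vbar.asIdeal) (hne : vbar ≠ v) (hκ : κ.IsAnticyclotomic) :
    Nat.card ((resH1Hom (ContinuousMonoidHom.id (decompIn κ.kerSubgroup vbar))
        (AddSubgroup.inclusion (geomTorsion_le_geomPrimaryTorsion (W.baseChange K) p)) (fun _ _ ↦ rfl) :
          subgroupH1 (decompIn κ.kerSubgroup vbar) (geomTorsion (W.baseChange K) (p : ℤ)) →+
            subgroupH1 (decompIn κ.kerSubgroup vbar) ((W.baseChange K).geomPrimaryTorsion p)).ker) =
      Nat.card (FixedPoints.addSubgroup (GreenbergSelmer.decomp vbar) (geomTorsion (W.baseChange K) (p : ℤ))) := by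
  obtain ⟨τ, hτ, hτne⟩ := ZpExtension.exists_mem_inertia_apply_ne_one_of_isAnticyclotomic hK hp2 κ hκ hpvbar
    (adicCompletionPrime_mem_primesAbove K vbar)
  refine natCard_ker_kummer_decompIn_eq W κ hp2 hanom hGL hK hpv hpvbar hne ⟨τ, ?_, hτne⟩
  have e : GreenbergSelmer.inertia vbar = (adicCompletionPrime K vbar).inertia (absoluteGaloisGroup K) :=
    (inertia_adicCompletionPrime_eq_map_absInertia K vbar).symm
  rw [e]
  exact hτ

/-- **`E(K_{∞,v̄})[p^∞]` is FINITE and `#E_K[p]^{D_v̄} ≤ p`** (KY Prop. 1.3.3 (ii)–(iii) «finite and cyclic»: the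
`p`-torsion of `E(K_{∞,v̄})[p^∞]` is `E(K_v̄)[p]`, of order `≤ p`), on the binders of crux 2 and for every `κ` with
`κ(I_v̄) ≠ 1`. [cite: KellerYin2024, §1.3 Prop. 1.3.3 (ii)–(iii) (arXiv:2402.12781v2 TeX L922–960)] -/
theorem finite_and_natCard_fixedPoints_decomp_le (hp2 : p ≠ 2) (hanom : Anom W p)
    (hGL : ∀ Φ : AddSubgroup (geomTorsion W (p : ℤ)), IsRationalLine W p Φ → ¬ LineUnramifiedAt W p Φ)
    (hK : IsImaginaryQuadratic K) {v vbar : HeightOneSpectrum (𝓞 K)} (hpv : ((p : ℕ) : 𝓞 K) ∈ v.asIdeal)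
    (hpvbar : ((p : ℕ) : 𝓞 K) ∈ vbar.asIdeal) (hne : vbar ≠ v)
    (hram : ∃ τ ∈ GreenbergSelmer.inertia vbar, κ τ ≠ 1) :
    (FixedPoints.addSubgroup ↥(GreenbergSelmer.decomp vbar ⊓ κ.kerSubgroup) ((W.baseChange K).geomPrimaryTorsion p) :
        Set ((W.baseChange K).geomPrimaryTorsion p)).Finite ∧
      Nat.card (FixedPoints.addSubgroup (GreenbergSelmer.decomp vbar) (geomTorsion (W.baseChange K) (p : ℤ))) ≤ p := by
  refine ⟨localTowerTorsionFiniteAt_of_exists_inertia_apply_ne_one W hp2 hanom hGL hK hpv hpvbar hne κ hram, ?_⟩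
  obtain ⟨Φ, hΦle, hΦ, hstab⟩ := exists_stable_line_baseChange W (K := K) hanom.1
  obtain ⟨τ, hτ, P, hP, hτP⟩ := exists_mem_inertia_smul_ne W hp2 hanom hGL hK hpv hpvbar hne hΦle hΦ hstab
  -- `E_K[p]^{D_v̄} ≤ E_K[p]^{D_v̄ ⊓ ker κ}`, which has at most `p` points
  have hle := natCard_fixedPoints_geomTorsion_le κ (isClosed_decomp vbar) (mem_decompIn_iff κ.kerSubgroup vbar) Φ
    hΦle hΦ (GreenbergSelmer.inertia_le_decomp vbar hτ) (fun Q hQ ↦ hstab τ Q hQ) ⟨P, hP, hτP⟩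
  haveI : Finite (geomTorsion (W.baseChange K) (p : ℤ)) :=
    Nat.finite_of_card_ne_zero (by rw [natCard_geomTorsion_eq_sq (W.baseChange K)]; exact pow_ne_zero _ hp.out.ne_zero)
  refine le_trans (Nat.card_le_card_of_injective (fun y ↦ (⟨(y : geomTorsion (W.baseChange K) (p : ℤ)),
    (FixedPoints.mem_addSubgroup _ _ _).mpr fun h ↦ ?_⟩ :
      FixedPoints.addSubgroup (decompIn κ.kerSubgroup vbar) (geomTorsion (W.baseChange K) (p : ℤ)))) ?_) hle
  · exact (FixedPoints.mem_addSubgroup _ _ _).mp y.2 (h : GreenbergSelmer.decomp vbar)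
  · intro a b h
    exact Subtype.ext (congrArg (fun z : FixedPoints.addSubgroup (decompIn κ.kerSubgroup vbar)
      (geomTorsion (W.baseChange K) (p : ℤ)) ↦ (z : geomTorsion (W.baseChange K) (p : ℤ))) h)

end Summit.BirchSwinnertonDyer.BirchSwinnertonDyer.Theorems.AnomalousLocalTorsion
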